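import Summits.AtomisticToContinuum.FouriersLaw.Theorems.PhononMeanFreePathIncoherentChannelLightCone
import Summits.AtomisticToContinuum.FouriersLaw.Theorems.PhononMeanFreePathIncoherentChannelTwoHorizonsMean
import Summits.AtomisticToContinuum.FouriersLaw.Theorems.PhononMeanFreePathIncoherentBoundedCorrelationDecay
import Summits.AtomisticToContinuum.FouriersLaw.Theorems.PhononMeanFreePathIncoherentChannelTailBudget
import Summits.AtomisticToContinuum.FouriersLaw.Theorems.IncoherentChannel.Negative.LineResistance

/-!
# `IncoherentChannel`, line `two-horizons-forecast-loss` — the ONE-TIME ENGINE closes the coherent channel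

Helper file for the lead's stub `stub_forecastLoss` (the ENGINE) of crux `PhononMeanFreePath.IncoherentChannel`
(item stmt-AtomisticToContinuum-11811, route `PhononMeanFreePath`, sub-problem `FouriersLaw`), vocabulary of
`PhononMeanFreePathDefs`: `S_N(t) = fnorm … N t = ‖K_t p_N‖²_{L²(μ₀)}` (forecast norm of the far bath momentum),
`r_N(t) = pairCorr … N t = ⟨p_0, K_t p_N⟩_{μ₀}` (the route's coherent channel).

THE POINT. The route's rank-2 crux `CoherentDephasing` (`N ∫₀^∞ r_N² → 0`) follows from ONE VALUE of the forecast
norm per chain length: if for some `η ∈ (0,1)`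

  `N · S_N(N^η) → 0`   (the far-momentum forecast is `o(1/N)` at ONE sub-ballistic time),

then `CoherentDephasing` holds — no envelope, no rate, no integrability hypothesis. Inside the causal window
`(0, N^η]` nothing routed through the far forecast is correlated with `p_0` (the landed light cone `stub_lightCone`,
p92940: `r_N² ≤ ε_N` there with `N^{1+η} ε_N → 0`); beyond it, the WHOLE coherent budget still unspent at time
`t₁ = N^η` is at most `(T/2γ)·S_N(t₁)` — the TAIL BUDGET `(2γ/T) ∫_{t>t₁} r_N(t)² dt ≤ S_N(t₁)`, the semigroup form
of the time-resolved dissipation budget (p136614) — first taken as the hypothesis `hTail` (core lemma `oneTime_coherent_of_tailBudget`, by-name composition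
`coherentDephasing_of_oneTime_of_tailBudget`) and then DISCHARGED by the landed tail budget `forecastBudget_tail`
(p148747, from the general-`L²(μ₀)` budget `forecastBudget_timeResolved_of_sq_integrable`, p144914, and
Chapman–Kolmogorov): `pairCorr_sq_tail_le`, hence the registered closed form `coherentDephasing_of_oneTime` and,
over the proved siblings `NessUnique`, `BoundaryKubo`, `incoherentChannel_iff_fouriersLaw_of_oneTime`: under the
one-time engine the crux `IncoherentChannel` IS the conjunct `FouriersLaw`. Finally `oneTime_of_sqEnvelope`: any
`N`-uniform envelope `S_N(t) ≤ C(1+t)^{-α}` with `α > 1` gives the one-time hypothesis (with `η = (α+1)/(2α)`), so this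
is the weakest of the three registered engine forms (envelope `α > 2`, square envelope `α > 1`, one-time).
No definitions; nothing here closes an item.
-/

noncomputable section

namespace Summit.AtomisticToContinuum.FouriersLaw.Theorems.PhononMeanFreePath

open MeasureTheory Set Filter Topology
open scoped NNReal
open Literature.MathematicalPhysics.KineticTheory.HeatConduction
open Summit.AtomisticToContinuum.FouriersLaw.Theses.PhononMeanFreePath (CoherentDephasing IncoherentChannel)

/-- **One-time engine ⇒ the coherent channel closes, at one parameter point** (core lemma). If the tail of the
coherent channel beyond any time `t₁ ≥ 0` is budgeted by the forecast norm at `t₁`,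
`(2γ/T) ∫_{t>t₁} r_N(t)² dt ≤ S_N(t₁)` (hypothesis `hTail`), and `N · S_N(N^η) → 0` for some `η ∈ (0,1)`, then
`t ↦ r_N(t)²` is integrable on `(0,∞)` for every `N` and `N ∫₀^∞ r_N² → 0`: split `(0,∞)` at `N^η`; inside, the light
cone `stub_lightCone` gives `r_N² ≤ ε_N` with `N^{1+η} ε_N → 0`; beyond, `N ∫_{t>N^η} r_N² ≤ (T/2γ)·N·S_N(N^η) → 0`.
[folklore] -/
theorem oneTime_coherent_of_tailBudget {ω₂ lam β γ T : ℝ} (hω : 0 < ω₂) (hl : 0 < lam) (hβ : 0 < β)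
    (hγ : 0 < γ) (hT : 0 < T)
    (hTail : ∀ (N : ℕ) (t₁ : ℝ), 0 ≤ t₁ →
      (2 * γ / T) * ∫ s in Ioi t₁, (pairCorr ω₂ lam β γ T N s) ^ 2 ≤ fnorm ω₂ lam β γ T N t₁)
    {η : ℝ} (hη0 : 0 < η) (hη1 : η < 1)
    (h1 : Tendsto (fun N : ℕ => (N : ℝ) * fnorm ω₂ lam β γ T N ((N : ℝ) ^ η)) atTop (𝓝 0)) :
    (∀ N : ℕ, IntegrableOn (fun t => (pairCorr ω₂ lam β γ T N t) ^ 2) (Ioi (0 : ℝ))) ∧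
    Tendsto (fun N : ℕ => (N : ℝ) * ∫ t in Ioi (0 : ℝ), (pairCorr ω₂ lam β γ T N t) ^ 2) atTop (𝓝 0) := by
  have hint : ∀ N : ℕ, IntegrableOn (fun t => (pairCorr ω₂ lam β γ T N t) ^ 2) (Ioi (0 : ℝ)) := fun N =>
    Summit.AtomisticToContinuum.FouriersLaw.Theorems.IncoherentBounded.rN_sq_integrableOn hω hl.le hβ hγ hT N
  refine ⟨hint, ?_⟩
  obtain ⟨ε, hε, hwin⟩ := stub_lightCone ω₂ lam β γ hω hl hβ hγ T hT η hη0 hη1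
  -- causal window `a N = N^η`, window level `ε N`, tail bound `(T/2γ)·(N·S_N(N^η))`
  set a : ℕ → ℝ := fun N => (N : ℝ) ^ η with ha
  have ha0 : ∀ N, 0 ≤ a N := fun N => Real.rpow_nonneg (Nat.cast_nonneg N) η
  have hγT : 0 < 2 * γ / T := by positivity
  refine twoHorizons_tendsto_mul_integral_of_window_tail (f := fun N t => (pairCorr ω₂ lam β γ T N t) ^ 2)
    (a := a) (w := ε) (b := fun N => (T / (2 * γ)) * ((N : ℝ) * fnorm ω₂ lam β γ T N (a N)))
    ha0 hint ?_ ?_ ?_ ?_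
  · -- inside the window: `r² ≤ |P| + r² ≤ ε_N`
    intro N t ht hta
    rw [abs_of_nonneg (sq_nonneg _)]
    have h := hwin N t ht.le hta
    linarith [abs_nonneg (commonPast ω₂ lam β γ T N t)]
  · -- beyond the window: the tail budget
    refine Eventually.of_forall (fun N => ?_)
    have habs : ∫ t in Ioi (a N), |(pairCorr ω₂ lam β γ T N t) ^ 2| =
        ∫ t in Ioi (a N), (pairCorr ω₂ lam β γ T N t) ^ 2 :=
      integral_congr_ae (Eventually.of_forall fun t => abs_of_nonneg (sq_nonneg _))
    rw [habs]
    have h := hTail N (a N) (ha0 N)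
    have hI : ∫ s in Ioi (a N), (pairCorr ω₂ lam β γ T N s) ^ 2 =
        (T / (2 * γ)) * ((2 * γ / T) * ∫ s in Ioi (a N), (pairCorr ω₂ lam β γ T N s) ^ 2) := by
      field_simp
    have h' : ∫ s in Ioi (a N), (pairCorr ω₂ lam β γ T N s) ^ 2 ≤ (T / (2 * γ)) * fnorm ω₂ lam β γ T N (a N) := by
      rw [hI]
      exact mul_le_mul_of_nonneg_left h (by positivity)
    calc (N : ℝ) * ∫ s in Ioi (a N), (pairCorr ω₂ lam β γ T N s) ^ 2
        ≤ (N : ℝ) * ((T / (2 * γ)) * fnorm ω₂ lam β γ T N (a N)) :=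
          mul_le_mul_of_nonneg_left h' (Nat.cast_nonneg N)
      _ = (T / (2 * γ)) * ((N : ℝ) * fnorm ω₂ lam β γ T N (a N)) := by ring
  · -- window mass: `N · (ε_N · N^η) = N^{1+η} ε_N → 0`
    have hNa : ∀ N : ℕ, (N : ℝ) * (ε N * a N) = (N : ℝ) ^ (1 + η) * ε N := by
      intro N
      rw [ha, Real.rpow_add' (Nat.cast_nonneg N) (by linarith : (1:ℝ) + η ≠ 0), Real.rpow_one]
      ring
    simp_rw [hNa]
    exact hε
  · -- tail mass: `(T/2γ)·(N·S_N(N^η)) → 0`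
    simpa using h1.const_mul (T / (2 * γ))

/-- **The one-time engine closes the route's rank-2 crux `CoherentDephasing` (stmt-AtomisticToContinuum-11810) BY NAME**,
given the tail budget `(2γ/T) ∫_{t>t₁} r_N² ≤ S_N(t₁)` (hypothesis `hTail`, the semigroup form of the landed
time-resolved budget p136614) and `N·S_N(N^η) → 0` for some `η ∈ (0,1)` at every admissible parameter point.
CONDITIONAL on both hypotheses. [folklore] -/
theorem coherentDephasing_of_oneTime_of_tailBudget
    (hTail : ∀ ω₂ lam β γ : ℝ, 0 < ω₂ → 0 < lam → 0 < β → 0 < γ → ∀ T : ℝ, 0 < T → ∀ (N : ℕ) (t₁ : ℝ), 0 ≤ t₁ →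
      (2 * γ / T) * ∫ s in Ioi t₁, (pairCorr ω₂ lam β γ T N s) ^ 2 ≤ fnorm ω₂ lam β γ T N t₁)
    (h1 : ∀ ω₂ lam β γ : ℝ, 0 < ω₂ → 0 < lam → 0 < β → 0 < γ → ∀ T : ℝ, 0 < T →
      ∃ η : ℝ, 0 < η ∧ η < 1 ∧ Tendsto (fun N : ℕ => (N : ℝ) * fnorm ω₂ lam β γ T N ((N : ℝ) ^ η)) atTop (𝓝 0)) :
    CoherentDephasing := by
  intro ω₂ lam β γ hω hl hβ hγ T hT
  obtain ⟨η, hη0, hη1, hlim⟩ := h1 ω₂ lam β γ hω hl hβ hγ T hT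
  exact oneTime_coherent_of_tailBudget hω hl hβ hγ hT (hTail ω₂ lam β γ hω hl hβ hγ T hT) hη0 hη1 hlim

/-! ### Discharging the tail budget (landed `forecastBudget_tail`, p148747) -/

/-- **Tail budget of the coherent channel alone**: `(2γ/T) ∫_{t>t₁} r_N(t)² dt ≤ S_N(t₁)` for every `N` and
`t₁ ≥ 0` — drop the (nonnegative, integrable at fixed `N`) echo term from the landed tail budget
`forecastBudget_tail` (`(2γ/T)∫_{t>t₁}(r_N² + a_N²) ≤ S_N(t₁)`). [folklore] -/
theorem pairCorr_sq_tail_le {ω₂ lam β γ T : ℝ} (hω : 0 < ω₂) (hl : 0 ≤ lam) (hβ : 0 < β) (hγ : 0 < γ)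
    (hT : 0 < T) (N : ℕ) {t₁ : ℝ} (ht₁ : 0 ≤ t₁) :
    (2 * γ / T) * ∫ s in Ioi t₁, (pairCorr ω₂ lam β γ T N s) ^ 2 ≤ fnorm ω₂ lam β γ T N t₁ := by
  have h := forecastBudget_tail ω₂ lam β γ hω hl hβ hγ T hT N t₁ ht₁
  have hr : IntegrableOn (fun s => (pairCorr ω₂ lam β γ T N s) ^ 2) (Ioi t₁) :=
    (Summit.AtomisticToContinuum.FouriersLaw.Theorems.IncoherentBounded.rN_sq_integrableOn hω hl hβ hγ hT N).mono_set
      (Ioi_subset_Ioi ht₁)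
  have ha : IntegrableOn (fun s => (∫ z, z.2 (Fin.last N) * fcast ω₂ lam β γ T N s z
      ∂((pinnedChain ω₂ lam β γ).gibbsMeasure (N + 1) T)) ^ 2) (Ioi t₁) :=
    (aN_sq_integrableOn hω hl hβ hγ hT N).mono_set (Ioi_subset_Ioi ht₁)
  have hle : ∫ s in Ioi t₁, (pairCorr ω₂ lam β γ T N s) ^ 2 ≤
      ∫ s in Ioi t₁, ((pairCorr ω₂ lam β γ T N s) ^ 2 + (∫ z, z.2 (Fin.last N) * fcast ω₂ lam β γ T N s z
        ∂((pinnedChain ω₂ lam β γ).gibbsMeasure (N + 1) T)) ^ 2) :=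
    integral_mono hr (hr.add ha) (fun s => le_add_of_nonneg_right (sq_nonneg _))
  calc (2 * γ / T) * ∫ s in Ioi t₁, (pairCorr ω₂ lam β γ T N s) ^ 2
      ≤ (2 * γ / T) * ∫ s in Ioi t₁, ((pairCorr ω₂ lam β γ T N s) ^ 2 + (∫ z, z.2 (Fin.last N) *
          fcast ω₂ lam β γ T N s z ∂((pinnedChain ω₂ lam β γ).gibbsMeasure (N + 1) T)) ^ 2) :=
        mul_le_mul_of_nonneg_left hle (by positivity)
    _ ≤ fnorm ω₂ lam β γ T N t₁ := h

/-- **The coherent channel closes under the one-time engine, at one parameter point** (unconditional form of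
`oneTime_coherent_of_tailBudget`): if `N·S_N(N^η) → 0` for some `η ∈ (0,1)` then `t ↦ r_N(t)²` is integrable on
`(0,∞)` for every `N` and `N ∫₀^∞ r_N² → 0`. [folklore] -/
theorem oneTime_coherent {ω₂ lam β γ T : ℝ} (hω : 0 < ω₂) (hl : 0 < lam) (hβ : 0 < β) (hγ : 0 < γ)
    (hT : 0 < T) {η : ℝ} (hη0 : 0 < η) (hη1 : η < 1)
    (h1 : Tendsto (fun N : ℕ => (N : ℝ) * fnorm ω₂ lam β γ T N ((N : ℝ) ^ η)) atTop (𝓝 0)) :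
    (∀ N : ℕ, IntegrableOn (fun t => (pairCorr ω₂ lam β γ T N t) ^ 2) (Ioi (0 : ℝ))) ∧
    Tendsto (fun N : ℕ => (N : ℝ) * ∫ t in Ioi (0 : ℝ), (pairCorr ω₂ lam β γ T N t) ^ 2) atTop (𝓝 0) :=
  oneTime_coherent_of_tailBudget hω hl hβ hγ hT (fun N _ ht₁ => pairCorr_sq_tail_le hω hl.le hβ hγ hT N ht₁)
    hη0 hη1 h1

/-- **ONE-TIME ENGINE ⇒ `CoherentDephasing` (registered stub `coherentDephasing_of_oneTime`).** The route's rank-2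
crux `PhononMeanFreePath.CoherentDephasing` (stmt-AtomisticToContinuum-11810) BY NAME from ONE value of the forecast
norm per chain length: if at every admissible parameter point there is `η ∈ (0,1)` with `N · S_N(N^η) → 0`
(`S_N(t) = ‖K_t p_N‖²_{L²(μ₀)}`), then `CoherentDephasing`. Light cone inside the causal window (p92940), tail budget
beyond it (p148747 ← p144914). No envelope, no rate, no integrability hypothesis. CONDITIONAL on the one-time
hypothesis (open; at `lam = β = 0` it must fail, since there the conclusion fails by `HarmonicCoherentPersistence`
while the tail budget is the same dissipation identity). [folklore] -/
theorem coherentDephasing_of_oneTime : (∀ ω₂ lam β γ : ℝ, 0 < ω₂ → 0 < lam → 0 < β → 0 < γ → ∀ T : ℝ, 0 < T → ∃ η : ℝ, 0 < η ∧ η < 1 ∧ Tendsto (fun N : ℕ => (N : ℝ) * fnorm ω₂ lam β γ T N ((N : ℝ) ^ η)) atTop (𝓝 0)) → Summit.AtomisticToContinuum.FouriersLaw.Theses.PhononMeanFreePath.CoherentDephasing :=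
  fun h1 => coherentDephasing_of_oneTime_of_tailBudget
    (fun _ _ _ _ hω hl hβ hγ _ hT N _ ht₁ => pairCorr_sq_tail_le hω hl.le hβ hγ hT N ht₁) h1

/-- **Under the one-time engine the crux IS the conjunct**: `IncoherentChannel ↔ FouriersLaw` (the siblings
`NessUnique`, `BoundaryKubo` are theorems; `LineResistance.incoherentChannel_iff_fouriersLaw_of_coherentDephasing`).
CONDITIONAL on the one-time hypothesis. [folklore] -/
theorem incoherentChannel_iff_fouriersLaw_of_oneTime
    (h1 : ∀ ω₂ lam β γ : ℝ, 0 < ω₂ → 0 < lam → 0 < β → 0 < γ → ∀ T : ℝ, 0 < T →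
      ∃ η : ℝ, 0 < η ∧ η < 1 ∧ Tendsto (fun N : ℕ => (N : ℝ) * fnorm ω₂ lam β γ T N ((N : ℝ) ^ η)) atTop (𝓝 0)) :
    IncoherentChannel ↔ _root_.FouriersLaw :=
  Summit.AtomisticToContinuum.FouriersLaw.Theorems.IncoherentChannel.Negative.LineResistance.incoherentChannel_iff_fouriersLaw_of_coherentDephasing
    (coherentDephasing_of_oneTime h1)

/-! ### The one-time hypothesis is the weakest registered engine form -/

/-- **Any square-integrable-with-margin envelope gives the one-time hypothesis** (pure real analysis): if
`0 ≤ S_N(t) ≤ C(1+t)^{-α}` for all `N`, `t ≥ 0` with `α > 1`, then with `η = (α+1)/(2α) ∈ (0,1)`,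
`N·S_N(N^η) ≤ C·N^{(1-α)/2} → 0`. [folklore] -/
theorem oneTime_of_sqEnvelope {S : ℕ → ℝ → ℝ} {C α : ℝ} (hα : 1 < α) (hS0 : ∀ N t, 0 ≤ S N t)
    (henv : ∀ (N : ℕ) (t : ℝ), 0 ≤ t → S N t ≤ C * (1 + t) ^ (-α)) :
    ∃ η : ℝ, 0 < η ∧ η < 1 ∧ Tendsto (fun N : ℕ => (N : ℝ) * S N ((N : ℝ) ^ η)) atTop (𝓝 0) := by
  have hα0 : 0 < α := by linarith
  set η : ℝ := (α + 1) / (2 * α) with hηdef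
  have hη0 : 0 < η := by rw [hηdef]; positivity
  have hη1 : η < 1 := by rw [hηdef, div_lt_one (by positivity)]; linarith
  have hexp : 1 - η * α = (1 - α) / 2 := by rw [hηdef]; field_simp; ring
  have hneg : 1 - η * α < 0 := by rw [hexp]; linarith
  -- `C ≥ 0` from `0 ≤ S_0(0) ≤ C`
  have hC0 : 0 ≤ C := by
    have h := henv 0 0 le_rfl
    simp only [add_zero, Real.one_rpow, mul_one] at h
    exact (hS0 0 0).trans h
  refine ⟨η, hη0, hη1, ?_⟩
  have hlim : Tendsto (fun N : ℕ => C * (N : ℝ) ^ (1 - η * α)) atTop (𝓝 0) := by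
    simpa using (twoHorizons_tendsto_natCast_rpow_of_neg hneg).const_mul C
  refine squeeze_zero' (Eventually.of_forall fun N => mul_nonneg (Nat.cast_nonneg N) (hS0 N _)) ?_ hlim
  filter_upwards [eventually_ge_atTop 1] with N hN
  have hNpos : (0 : ℝ) < N := by exact_mod_cast Nat.lt_of_lt_of_le Nat.zero_lt_one hN
  have hNη : 0 < (N : ℝ) ^ η := Real.rpow_pos_of_pos hNpos η
  have h1 : (1 + (N : ℝ) ^ η) ^ (-α) ≤ ((N : ℝ) ^ η) ^ (-α) :=
    Real.rpow_le_rpow_of_nonpos hNη (by linarith) (by linarith)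
  have h2 : ((N : ℝ) ^ η) ^ (-α) = (N : ℝ) ^ (-(η * α)) := by
    rw [← Real.rpow_mul hNpos.le, mul_neg]
  calc (N : ℝ) * S N ((N : ℝ) ^ η) ≤ (N : ℝ) * (C * (1 + (N : ℝ) ^ η) ^ (-α)) :=
        mul_le_mul_of_nonneg_left (henv N _ hNη.le) hNpos.le
    _ ≤ (N : ℝ) * (C * ((N : ℝ) ^ η) ^ (-α)) := by gcongr
    _ = C * ((N : ℝ) ^ (1 : ℝ) * (N : ℝ) ^ (-(η * α))) := by rw [h2, Real.rpow_one]; ring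
    _ = C * (N : ℝ) ^ (1 - η * α) := by rw [← Real.rpow_add hNpos, sub_eq_add_neg]

/-- **The registered engine forms imply the one-time hypothesis**: the square-integrable envelope (`α > 1`,
hypothesis of the landed `coherentDephasing_of_forecastLoss_sq`, p139625) — and a fortiori the registered
`stub_forecastLoss` (`α > 2`) — give `∃ η ∈ (0,1), N·S_N(N^η) → 0` at every parameter point. [folklore] -/
theorem oneTime_of_forecastLoss_sq
    (h : ∀ ω₂ lam β γ : ℝ, 0 < ω₂ → 0 < lam → 0 < β → 0 < γ → ∀ T : ℝ, 0 < T →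
      ∃ C α : ℝ, 1 < α ∧ ∀ (N : ℕ) (t : ℝ), 0 ≤ t → fnorm ω₂ lam β γ T N t ≤ C * (1 + t) ^ (-α)) :
    ∀ ω₂ lam β γ : ℝ, 0 < ω₂ → 0 < lam → 0 < β → 0 < γ → ∀ T : ℝ, 0 < T →
      ∃ η : ℝ, 0 < η ∧ η < 1 ∧ Tendsto (fun N : ℕ => (N : ℝ) * fnorm ω₂ lam β γ T N ((N : ℝ) ^ η)) atTop (𝓝 0) := by
  intro ω₂ lam β γ hω hl hβ hγ T hT
  obtain ⟨C, α, hα, henv⟩ := h ω₂ lam β γ hω hl hβ hγ T hT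
  exact oneTime_of_sqEnvelope hα (fun N t => fnorm_nonneg ω₂ lam β γ T N t) henv

end Summit.AtomisticToContinuum.FouriersLaw.Theorems.PhononMeanFreePath

end
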